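import Mathlib
import Literature.NumberTheory.LFunctions.Zhang2022.Section2CriticalLineReality
import Literature.NumberTheory.LFunctions.DirichletLogDerivDisc
import HarnessLib

/-!
# Zhang (2022) §5, toward (5.16): polynomial growth of `L(z,ψ)` on the discs `|z − (2+it)| ≤ 3`

Topic `Literature/NumberTheory/LFunctions/Zhang2022` (Landau–Siegel adjudication tree;
verdict-neutral). Y. Zhang, *Discrete mean estimates and the Landau–Siegel zero*,
arXiv:2211.02515v1 (2022) [Zhang2022LandauSiegel]. The local partial-fraction formula (5.16)
(p. 29–30, tex L1638; DAG node `Z22:(5.16)`, typed as `Typed.Section05C.Eq516`) sums over the zeros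
`|ρ − s′| < 1` about `s′ ≈ 1/2 + it`, a window reaching `Re ρ > −1/2`; the Jensen / Lemma-α
argument behind it (carried out in `Section5Eq516.lean`) therefore needs a bound for `L(z,ψ)` of
polynomial size in `p` and `t` on the disc `|z − (2+it)| ≤ 3`, i.e. down to `Re z = −1`, where the
tree's `‖L(z,χ)‖ ≤ q‖z‖Z` (`σ ≥ 1/4`, MV Lemma 10.15) does not reach. This file supplies it from
the functional equation `L(z,θ) = Z(z,θ)L(1−z,θ̄)` (tree `GammaFactor.LFunction_eq_Zfac_mul`,
(2.4) `GammaFactor.Zfac_eq`) and Stirling's formula for `ϑ = χ` (tree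
`abs_norm_rsChi_sub_rpow_le`, Titchmarsh (4.12.3)):

* `DiscGrowth.norm_vartheta_le` — `‖ϑ(σ+iτ)‖ ≤ 2τ²` for `|σ| ≤ 1`, `τ ≥ 152`;
* `DiscGrowth.norm_Zfac_le` — `‖Z(σ+iτ,θ)‖ ≤ 4k²τ²` for `θ` primitive mod `k`, same range;
* `DiscGrowth.norm_LFunction_le_on_disc_three` — for `θ` primitive mod `k ≠ 1`, `t ≥ 160`,
  `|z − (2+it)| ≤ 3`: `‖L(z,θ)‖ ≤ 4Z·k³(t+6)³` (`Z = DirichletDisc.Zc = Σ n^{−5/4}`).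

No new definitions, no new named facts; nothing here bears on Theorems 1–2 of the source or on
the cell's verdict on (8.24).

## References

* Y. Zhang, arXiv:2211.02515v1 (2022), §2 (2.2)–(2.4), §5 (5.16). [cite: Zhang2022LandauSiegel, (5.16) p.29]
* H. L. Montgomery, R. C. Vaughan, *Multiplicative Number Theory I*, CUP 2007, §10.1 Cor. 10.5,
  Lemma 10.15. [cite: MontgomeryVaughan2007, Lemma 10.15]
* E. C. Titchmarsh, *The Theory of the Riemann Zeta-Function*, 2nd ed., OUP 1986, §4.12 (4.12.3).
  [cite: Titchmarsh1986, §4.12 (4.12.3)]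
-/

noncomputable section

open Complex Real Set Metric

namespace Literature.NumberTheory.LFunctions.Zhang2022.DiscGrowth

/-! ## §1. Polynomial growth of `L(z,θ)` on the disc `|z − (2+it)| ≤ 3` -/

/-- **Stirling for `ϑ`** (Titchmarsh (4.12.3) via the tree): for `|σ| ≤ 1` and `τ ≥ 152`,
`‖ϑ(σ+iτ)‖ ≤ 2τ²` (`‖ϑ(σ+iτ)‖ ≤ 2(τ/2π)^{1/2−σ} ≤ 2(τ/2π)² ≤ 2τ²`).
[cite: Titchmarsh1986, §4.12 (4.12.3)] -/
theorem norm_vartheta_le {σ τ : ℝ} (hσ : |σ| ≤ 1) (hτ : 152 ≤ τ) :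
    ‖GammaFactor.vartheta (σ + τ * I)‖ ≤ 2 * τ ^ 2 := by
  have hτ0 : 0 < τ := by linarith
  have him : (σ + τ * I : ℂ).im ≠ 0 := by simp; exact hτ0.ne'
  rw [GammaFactor.vartheta_eq_rsChi him]
  have h := abs_norm_rsChi_sub_rpow_le (A := 1) (σ := σ) (t := τ) le_rfl hσ
    (by norm_num; linarith)
  obtain ⟨hσ1, hσ2⟩ := abs_le.mp hσ
  have hX0 : 0 ≤ (τ / (2 * π)) ^ (1 / 2 - σ) := Real.rpow_nonneg (by positivity) _
  have h1 : ‖SiegelIntegral.rsChi (σ + τ * I)‖ ≤ 2 * (τ / (2 * π)) ^ (1 / 2 - σ) := by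
    have h2 := (abs_le.mp h).2
    have h3 : 38 * (1 + 1) ^ 2 / τ * (τ / (2 * π)) ^ (1 / 2 - σ)
        ≤ 1 * (τ / (2 * π)) ^ (1 / 2 - σ) := by
      refine mul_le_mul_of_nonneg_right ?_ hX0
      rw [div_le_one hτ0]; norm_num; linarith
    linarith
  have hbase : 1 ≤ τ / (2 * π) := by
    rw [le_div_iff₀ (by positivity)]; nlinarith [Real.pi_lt_four]
  have hX2 : (τ / (2 * π)) ^ (1 / 2 - σ) ≤ τ ^ 2 := by
    calc (τ / (2 * π)) ^ (1 / 2 - σ) ≤ (τ / (2 * π)) ^ (2 : ℝ) :=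
          Real.rpow_le_rpow_of_exponent_le hbase (by linarith)
      _ = (τ / (2 * π)) ^ 2 := by norm_num
      _ ≤ τ ^ 2 := by
          apply pow_le_pow_left₀ (by positivity)
          rw [div_le_iff₀ (by positivity)]
          nlinarith [Real.pi_gt_three]
  linarith

/-- **`‖Z(σ+iτ,θ)‖ ≤ 4k²τ²`** for `θ` primitive mod `k`, `|σ| ≤ 1`, `τ ≥ 152`: from (2.4)
`Z = θ(−1)τ(θ)k^{−s}ϑ(s)(1+r)` (`GammaFactor.Zfac_eq`) with `|τ(θ)| = √k ≤ k`, `|k^{−s}| = k^{−σ} ≤ k`,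
`‖ϑ‖ ≤ 2τ²`, `|1+r| ≤ 2`. [cite: Zhang2022LandauSiegel, §2 (2.4)] -/
theorem norm_Zfac_le {k : ℕ} [NeZero k] {θ : DirichletCharacter ℂ k} (hθ : θ.IsPrimitive)
    {σ τ : ℝ} (hσ : |σ| ≤ 1) (hτ : 152 ≤ τ) :
    ‖GammaFactor.Zfac θ (σ + τ * I)‖ ≤ 4 * (k : ℝ) ^ 2 * τ ^ 2 := by
  have hτ0 : 0 < τ := by linarith
  have hk1 : (1 : ℝ) ≤ k := by exact_mod_cast NeZero.one_le
  have himv : (σ + τ * I : ℂ).im = τ := by simp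
  have him : 0 < (σ + τ * I : ℂ).im := by rw [himv]; exact hτ0
  obtain ⟨hσ1, hσ2⟩ := abs_le.mp hσ
  rw [GammaFactor.Zfac_eq θ him]
  have h1 : ‖θ (-1)‖ ≤ 1 := θ.norm_le_one _
  have h2 : ‖GammaFactor.tau θ‖ ≤ k := by
    have hsq := Literature.NumberTheory.Sieve.LargeSieve.norm_gaussSum_sq hθ
    have heq : ‖GammaFactor.tau θ‖ = Real.sqrt k := by
      rw [← hsq, Real.sqrt_sq (norm_nonneg _)]
    rw [heq, Real.sqrt_le_left (by positivity)]
    nlinarith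
  have h3 : ‖(k : ℂ) ^ (-(σ + τ * I : ℂ))‖ ≤ k := by
    rw [Complex.norm_natCast_cpow_of_pos (NeZero.pos k)]
    have hre : (-(σ + τ * I : ℂ)).re = -σ := by simp
    rw [hre]
    calc (k : ℝ) ^ (-σ) ≤ (k : ℝ) ^ (1 : ℝ) := Real.rpow_le_rpow_of_exponent_le hk1 (by linarith)
      _ = k := Real.rpow_one _
  have h4 : ‖GammaFactor.vartheta (σ + τ * I)‖ ≤ 2 * τ ^ 2 := norm_vartheta_le hσ hτ
  have h5 : ‖1 + GammaFactor.corr θ (σ + τ * I)‖ ≤ 2 := by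
    have hc := GammaFactor.norm_corr_le θ (s := σ + τ * I) (by rw [himv]; linarith)
    rw [himv] at hc
    have he : Real.exp (-π * τ) ≤ 1 / 3 := GammaFactor.exp_neg_pi_mul_le (by linarith)
    calc ‖1 + GammaFactor.corr θ (σ + τ * I)‖ ≤ ‖(1 : ℂ)‖ + ‖GammaFactor.corr θ (σ + τ * I)‖ :=
          norm_add_le _ _
      _ ≤ 1 + 3 * Real.exp (-π * τ) := by rw [norm_one]; linarith
      _ ≤ 2 := by linarith
  calc ‖θ (-1) * GammaFactor.tau θ * (k : ℂ) ^ (-(σ + τ * I : ℂ)) *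
          GammaFactor.vartheta (σ + τ * I) * (1 + GammaFactor.corr θ (σ + τ * I))‖
      = ‖θ (-1)‖ * ‖GammaFactor.tau θ‖ * ‖(k : ℂ) ^ (-(σ + τ * I : ℂ))‖ *
          ‖GammaFactor.vartheta (σ + τ * I)‖ * ‖1 + GammaFactor.corr θ (σ + τ * I)‖ := by
        simp only [norm_mul]
    _ ≤ 1 * k * k * (2 * τ ^ 2) * 2 := by
        gcongr
    _ = 4 * (k : ℝ) ^ 2 * τ ^ 2 := by ring

/-- On `|z − (2+it)| ≤ 3` with `t ≥ 0`: `‖z‖ ≤ t + 5`. [folklore] -/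
private theorem norm_le_of_mem_closedBall_three {t : ℝ} (ht : 0 ≤ t) {z : ℂ}
    (hz : z ∈ closedBall (2 + (t : ℂ) * I) 3) : ‖z‖ ≤ t + 5 := by
  rw [mem_closedBall, dist_eq_norm] at hz
  have hc : ‖(2 : ℂ) + t * I‖ ≤ 2 + t := by
    refine (norm_add_le _ _).trans ?_
    rw [Complex.norm_ofNat, norm_mul, norm_real, norm_I, mul_one, Real.norm_eq_abs,
      abs_of_nonneg ht]
  have h3 : ‖z‖ ≤ ‖(2 : ℂ) + t * I‖ + ‖z - (2 + t * I)‖ := by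
    calc ‖z‖ = ‖(2 + t * I) + (z - (2 + t * I))‖ := by ring_nf
      _ ≤ _ := norm_add_le _ _
  linarith

/-- **Polynomial growth of `L(z,θ)` on the disc `|z − (2+it)| ≤ 3`** (`θ` primitive mod `k ≠ 1`,
`t ≥ 160`): `‖L(z,θ)‖ ≤ 4Z·k³(t+6)³`. On `Re z ≥ 1/4` this is the tree's `‖L‖ ≤ k‖z‖Z`
(MV Lemma 10.15); on `Re z < 1/4` the functional equation `L(z,θ) = Z(z,θ)L(1−z,θ̄)`
(`GammaFactor.LFunction_eq_Zfac_mul`) with `‖Z(z,θ)‖ ≤ 4k²(Im z)²` and `‖L(1−z,θ̄)‖ ≤ k‖1−z‖Z`.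
[cite: MontgomeryVaughan2007, §10.1 Cor. 10.5 and Lemma 10.15] -/
theorem norm_LFunction_le_on_disc_three {k : ℕ} [NeZero k] {θ : DirichletCharacter ℂ k}
    (hθ : θ.IsPrimitive) (hk : k ≠ 1) {t : ℝ} (ht : 160 ≤ t) {z : ℂ}
    (hz : z ∈ closedBall (2 + (t : ℂ) * I) 3) :
    ‖θ.LFunction z‖ ≤ 4 * DirichletDisc.Zc * (k : ℝ) ^ 3 * (t + 6) ^ 3 := by
  have hk1 : (1 : ℝ) ≤ k := by exact_mod_cast NeZero.one_le
  have hZ1 : 1 ≤ DirichletDisc.Zc := DirichletDisc.one_le_Zc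
  have ht0 : 0 ≤ t := by linarith
  have him : |z.im - t| ≤ 3 := DirichletDisc.disc_abs_im_sub_le hz
  obtain ⟨him1, him2⟩ := abs_le.mp him
  have hre : -1 ≤ z.re := by have := DirichletDisc.disc_re_ge hz; linarith
  have hzn : ‖z‖ ≤ t + 5 := norm_le_of_mem_closedBall_three ht0 hz
  have hθ1 : θ ≠ 1 := GammaFactor.ne_one_of_isPrimitive hθ hk
  have hk3 : (k : ℝ) ≤ (k : ℝ) ^ 3 := le_self_pow₀ hk1 (by norm_num)
  have ht6 : (1 : ℝ) ≤ t + 6 := by linarith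
  by_cases hzre : 1 / 4 ≤ z.re
  · -- the crude bound on `Re z ≥ 1/4`
    calc ‖θ.LFunction z‖ ≤ k * ‖z‖ * DirichletDisc.Zc :=
          DirichletZFR.norm_LFunction_le_of_re_ge θ hθ1 hzre
      _ ≤ k * (t + 5) * DirichletDisc.Zc := by gcongr
      _ = DirichletDisc.Zc * k * (t + 5) := by ring
      _ ≤ 4 * DirichletDisc.Zc * (k : ℝ) ^ 3 * (t + 6) ^ 3 := by
          have h1 : t + 5 ≤ (t + 6) ^ 3 := by
            calc t + 5 ≤ t + 6 := by linarith
              _ ≤ (t + 6) ^ 3 := le_self_pow₀ ht6 (by norm_num)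
          have h2 : DirichletDisc.Zc ≤ 4 * DirichletDisc.Zc := by linarith
          have h0 : (0 : ℝ) ≤ DirichletDisc.Zc := by linarith
          calc DirichletDisc.Zc * k * (t + 5) ≤ (4 * DirichletDisc.Zc) * (k : ℝ) ^ 3 * (t + 6) ^ 3 :=
                mul_le_mul (mul_le_mul h2 hk3 (by positivity) (by positivity)) h1 (by linarith)
                  (by positivity)
            _ = _ := by ring
  · -- the functional equation on `Re z < 1/4`
    push Not at hzre
    have hzim : 157 ≤ z.im := by linarith
    have hzim0 : z.im ≠ 0 := by linarith
    rw [GammaFactor.LFunction_eq_Zfac_mul hθ hk hzim0, norm_mul]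
    have hZ : ‖GammaFactor.Zfac θ z‖ ≤ 4 * (k : ℝ) ^ 2 * z.im ^ 2 := by
      have h := norm_Zfac_le hθ (σ := z.re) (τ := z.im) (abs_le.mpr ⟨by linarith, by linarith⟩)
        (by linarith)
      rwa [Complex.re_add_im] at h
    have hL1 : ‖θ⁻¹.LFunction (1 - z)‖ ≤ k * (t + 6) * DirichletDisc.Zc := by
      have h1 : θ⁻¹ ≠ 1 := inv_ne_one.mpr hθ1
      have h1z : ‖1 - z‖ ≤ t + 6 := by
        calc ‖1 - z‖ ≤ ‖(1 : ℂ)‖ + ‖z‖ := norm_sub_le _ _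
          _ ≤ 1 + (t + 5) := by rw [norm_one]; linarith
          _ = t + 6 := by ring
      calc ‖θ⁻¹.LFunction (1 - z)‖ ≤ k * ‖1 - z‖ * DirichletDisc.Zc :=
            DirichletZFR.norm_LFunction_le_of_re_ge θ⁻¹ h1 (by simp; linarith)
        _ ≤ k * (t + 6) * DirichletDisc.Zc := by gcongr
    have him_sq : z.im ^ 2 ≤ (t + 6) ^ 2 := pow_le_pow_left₀ (by linarith) (by linarith) 2
    calc ‖GammaFactor.Zfac θ z‖ * ‖θ⁻¹.LFunction (1 - z)‖
        ≤ (4 * (k : ℝ) ^ 2 * z.im ^ 2) * (k * (t + 6) * DirichletDisc.Zc) :=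
          mul_le_mul hZ hL1 (norm_nonneg _) (by positivity)
      _ = 4 * DirichletDisc.Zc * (k : ℝ) ^ 3 * (z.im ^ 2 * (t + 6)) := by ring
      _ ≤ 4 * DirichletDisc.Zc * (k : ℝ) ^ 3 * ((t + 6) ^ 2 * (t + 6)) := by gcongr
      _ = 4 * DirichletDisc.Zc * (k : ℝ) ^ 3 * (t + 6) ^ 3 := by ring

end Literature.NumberTheory.LFunctions.Zhang2022.DiscGrowth
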